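import Literature.NumberTheory.LFunctions.DirichletLOneTail
import Mathlib.NumberTheory.Harmonic.Bounds
import Mathlib.Analysis.SpecialFunctions.Log.Deriv
import HarnessLib

/-!
# `|L(1, χ)| ≤ H_{[(q−1)/2]} ≤ log q` for every non-principal Dirichlet character mod `q`

Topic `Literature/NumberTheory/LFunctions`, namespace `Literature.NumberTheory.LFunctions.DirichletAbel`
(continuing `SiegelAbelSummation.lean` and `DirichletLOneTail.lean`: the partial sums
`S(N) = ∑_{n ≤ N} χ(n)` and the Abel series `L(1, χ) = ∑_{n ≥ 1} S(n)(1/n − 1/(n+1))`).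
Everything here is PROVED (theorems only; no definitions, no named facts).

This is the elementary majoration used by J. Oesterlé, *Le problème de Gauss sur le nombre de
classes*, Enseign. Math. (2) 34 (1988), II §3, proof of the Proposition p. 57 (there for the
Kronecker character `χ = (−d/·)`):

> «pour tout nombre réel `x > 0`, la somme `M(x) = ∑_{n ≤ x} χ(n)` est majorée par
> `N(x) = inf([x], [(d−1)/2])`, et l'on a donc, en intégrant par parties
> `∑ χ(n)/n = ∫₁^∞ M(x) x⁻² dx ≤ ∫₁^∞ N(x) x⁻² dx = ∑_{n ≤ [(d−1)/2]} 1/n ≤ log d`.»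

The printed argument uses only the periodicity of `χ` and `∑_{n mod q} χ(n) = 0`, so it is run here
for an arbitrary character `χ ≠ 1` mod `q`, in the discrete form of the Abel series
(`∫_n^{n+1} x⁻² dx = 1/n − 1/(n+1)`):

* `partialSum_level_sub_one`, `partialSum_reflect` — `S(q − 1) = 0` and the reflection
  `S(q − 1 − k) = −χ(−1) S(k)` (`0 ≤ k ≤ q − 1`), whence
* `norm_partialSum_le_min`, `norm_partialSum_le_half` — **`|S(k)| ≤ min(k, q − 1 − k)`** and
  **`|S(N)| ≤ [(q−1)/2]`** for all `N` (Oesterlé's `M(x) ≤ N(x)`);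
* `hasSum_majorant` (with the private partial-sum evaluations `sum_majorant_eq_of_le/_of_ge`) —
  `∑_{n ≥ 1} min(n, D)(1/n − 1/(n+1)) = H_D` (the value of `∫₁^∞ N(x) x⁻² dx`);
* `norm_LFunction_one_le_harmonic` — **`|L(1, χ)| ≤ H_{[(q−1)/2]}`** for every `χ ≠ 1` mod `q`;
* `harmonic_le_log_two_mul_add_one` — `H_D ≤ log(2D + 1)` (induction with
  `log(1 + 1/(D + ½)) ≥ 1/(D + 1)`, the first term of Mathlib's series `Real.hasSum_log_one_add_inv`);
* `norm_LFunction_one_le_log` — **`|L(1, χ)| ≤ log q`** for every `χ ≠ 1` mod `q`.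

The class-number consequence `h(−d) ≤ π⁻¹ √d log d` (Oesterlé's (27)) is in
`Literature/NumberTheory/QuadraticFields/ClassNumberLeSqrtMulLog.lean`.

## References

* [Oesterle1988Gauss] J. Oesterlé, *Le problème de Gauss sur le nombre de classes*, Enseign. Math.
  (2) 34 (1988), 43–67: II §3, Proposition p. 57, (27) and its proof.
* [MontgomeryVaughan2007] H. L. Montgomery, R. C. Vaughan, *Multiplicative Number Theory I*, §4.3
  (4.23) (`|S(N)| ≤ q`), §1.3 Thm. 1.3 (Abel summation).
-/

noncomputable section

open Complex Filter Topology Finset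

namespace Literature.NumberTheory.LFunctions.DirichletAbel

variable {q : ℕ} [NeZero q] (χ : DirichletCharacter ℂ q)

/-! ### The reflection symmetry of the partial sums -/

/-- A non-principal character has level `q ≠ 1`. [folklore] -/
private theorem level_ne_one (hχ : χ ≠ 1) : q ≠ 1 := by
  rintro rfl
  exact hχ (DirichletCharacter.level_one χ)

/-- `χ(0) = 0` for a non-principal character (its level is `> 1`). [folklore] -/
private theorem apply_zero_eq_zero (hχ : χ ≠ 1) : χ (0 : ZMod q) = 0 := by
  have h : ¬IsUnit ((0 : ℕ) : ZMod q) := by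
    rw [ZMod.isUnit_iff_coprime, Nat.coprime_zero_left]
    exact level_ne_one χ hχ
  rw [Nat.cast_zero] at h
  exact MulChar.map_nonunit χ h

/-- `S(q − 1) = 0` for `χ ≠ 1`: `S(q) = ∑_{n mod q} χ(n) = 0` and `χ(q) = χ(0) = 0`.
[cite: MontgomeryVaughan2007, §4.3 eq. (4.23)] -/
theorem partialSum_level_sub_one (hχ : χ ≠ 1) : partialSum χ (q - 1) = 0 := by
  have hq : 1 ≤ q := NeZero.one_le
  have hS : partialSum χ q = 0 := by simpa using partialSum_add_level χ hχ 0
  have h := partialSum_succ χ (q - 1)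
  rw [Nat.sub_add_cancel hq, hS, ZMod.natCast_self, apply_zero_eq_zero χ hχ, add_zero] at h
  exact h.symm

/-- **Reflection of the partial sums**: for `χ ≠ 1` mod `q` and `0 ≤ k ≤ q − 1`,
`S(q − 1 − k) = −χ(−1) · S(k)`, because `S(q−1) = 0` and the top block
`∑_{q−k ≤ n ≤ q−1} χ(n) = ∑_{1 ≤ m ≤ k} χ(−m) = χ(−1) S(k)`. This is the symmetry behind
Oesterlé's «`M(x)` est majorée par `inf([x], [(d−1)/2])`» (p. 57).
[cite: Oesterle1988Gauss, II §3, proof of the Proposition p. 57] -/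
theorem partialSum_reflect (hχ : χ ≠ 1) {k : ℕ} (hk : k ≤ q - 1) :
    partialSum χ (q - 1 - k) = -(χ (-1) * partialSum χ k) := by
  have h0 := partialSum_level_sub_one χ hχ
  -- split `S(q-1)` after the first `q-1-k` terms
  have hsplit : partialSum χ (q - 1) =
      partialSum χ (q - 1 - k) + ∑ j ∈ range k, χ (((q - 1 - k + j) + 1 : ℕ) : ZMod q) := by
    unfold partialSum
    conv_lhs => rw [show q - 1 = (q - 1 - k) + k by omega]
    rw [sum_range_add]
  -- the top block, reflected: `j ↦ k - 1 - j`
  set f : ℕ → ℂ := fun i => χ ((q - (i + 1) : ℕ) : ZMod q) with hf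
  have hblock : ∑ j ∈ range k, χ (((q - 1 - k + j) + 1 : ℕ) : ZMod q) = ∑ i ∈ range k, f i := by
    rw [← sum_range_reflect f k]
    refine sum_congr rfl fun j hj => ?_
    rw [mem_range] at hj
    simp only [hf]
    congr 2
    omega
  have hneg : ∑ i ∈ range k, f i = χ (-1) * partialSum χ k := by
    unfold partialSum
    rw [mul_sum]
    refine sum_congr rfl fun i hi => ?_
    rw [mem_range] at hi
    simp only [hf]
    rw [Nat.cast_sub (by omega : i + 1 ≤ q), ZMod.natCast_self, zero_sub, ← neg_one_mul, map_mul]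
  rw [hsplit, hblock, hneg] at h0
  linear_combination h0

/-- **`|S(k)| ≤ min(k, q − 1 − k)`** for `χ ≠ 1` mod `q` and `0 ≤ k ≤ q − 1` (trivial bound and its
reflection). [cite: Oesterle1988Gauss, II §3, proof of the Proposition p. 57] -/
theorem norm_partialSum_le_min (hχ : χ ≠ 1) {k : ℕ} (hk : k ≤ q - 1) :
    ‖partialSum χ k‖ ≤ ((min k (q - 1 - k) : ℕ) : ℝ) := by
  rw [Nat.cast_min]
  refine le_min (norm_partialSum_le_self χ k) ?_
  -- `S(k) = -χ(-1) S(q-1-k)` by reflecting `q-1-k`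
  have hk' : q - 1 - k ≤ q - 1 := Nat.sub_le _ _
  have h := partialSum_reflect χ hχ hk'
  rw [show q - 1 - (q - 1 - k) = k by omega] at h
  rw [h, norm_neg, norm_mul]
  calc ‖χ (-1)‖ * ‖partialSum χ (q - 1 - k)‖ ≤ 1 * ‖partialSum χ (q - 1 - k)‖ := by
        gcongr; exact χ.norm_le_one _
    _ ≤ ((q - 1 - k : ℕ) : ℝ) := by rw [one_mul]; exact norm_partialSum_le_self χ _

/-- **`|S(N)| ≤ [(q − 1)/2]` for every `N`** (`χ ≠ 1` mod `q`): reduce `N` mod `q` by periodicity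
and use `|S(k)| ≤ min(k, q − 1 − k) ≤ (q − 1)/2`. This is Oesterlé's bound `M(x) ≤ [(d−1)/2]`.
[cite: Oesterle1988Gauss, II §3, proof of the Proposition p. 57] -/
theorem norm_partialSum_le_half (hχ : χ ≠ 1) (N : ℕ) :
    ‖partialSum χ N‖ ≤ (((q - 1) / 2 : ℕ) : ℝ) := by
  induction N using Nat.strong_induction_on with
  | _ N ih =>
    rcases lt_or_ge N q with hN | hN
    · have hk : N ≤ q - 1 := by omega
      refine (norm_partialSum_le_min χ hχ hk).trans ?_
      exact_mod_cast (by omega : min N (q - 1 - N) ≤ (q - 1) / 2)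
    · obtain ⟨k, rfl⟩ := Nat.exists_eq_add_of_le hN
      rw [add_comm, partialSum_add_level χ hχ]
      exact ih k (by have := NeZero.pos q; omega)

/-! ### The majorant series `∑ min(n, D)(1/n − 1/(n+1)) = H_D` -/

/-- Partial sums of the majorant, first regime (`N ≤ D`):
`∑_{n < N} min(n+1, D)(1/(n+1) − 1/(n+2)) = H_N − N/(N+1)`. [folklore] -/
private theorem sum_majorant_eq_of_le (D : ℕ) {N : ℕ} (hN : N ≤ D) :
    ∑ n ∈ range N, ((min (n + 1) D : ℕ) : ℝ) * (1 / ((n : ℝ) + 1) - 1 / ((n : ℝ) + 2)) =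
      (harmonic N : ℝ) - N / ((N : ℝ) + 1) := by
  induction N with
  | zero => simp
  | succ N ih =>
    rw [sum_range_succ, ih (by omega), min_eq_left (by omega : N + 1 ≤ D)]
    push_cast [harmonic_succ]
    field_simp
    ring

/-- Partial sums of the majorant, second regime (`N ≥ D`):
`∑_{n < N} min(n+1, D)(1/(n+1) − 1/(n+2)) = H_D − D/(N+1)`. [folklore] -/
private theorem sum_majorant_eq_of_ge (D : ℕ) {N : ℕ} (hN : D ≤ N) :
    ∑ n ∈ range N, ((min (n + 1) D : ℕ) : ℝ) * (1 / ((n : ℝ) + 1) - 1 / ((n : ℝ) + 2)) =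
      (harmonic D : ℝ) - D / ((N : ℝ) + 1) := by
  induction N, hN using Nat.le_induction with
  | base => exact sum_majorant_eq_of_le D le_rfl
  | succ N hDN ih =>
    rw [sum_range_succ, ih, min_eq_right (by omega : D ≤ N + 1)]
    push_cast
    field_simp
    ring

/-- **`∑_{n ≥ 1} min(n, D)(1/n − 1/(n+1)) = H_D`** (Oesterlé's `∫₁^∞ N(x) x⁻² dx = ∑_{n ≤ D} 1/n`).
[cite: Oesterle1988Gauss, II §3, proof of the Proposition p. 57] -/
theorem hasSum_majorant (D : ℕ) :
    HasSum (fun n : ℕ => ((min (n + 1) D : ℕ) : ℝ) * (1 / ((n : ℝ) + 1) - 1 / ((n : ℝ) + 2)))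
      (harmonic D : ℝ) := by
  have hnn : ∀ n : ℕ, 0 ≤ ((min (n + 1) D : ℕ) : ℝ) * (1 / ((n : ℝ) + 1) - 1 / ((n : ℝ) + 2)) :=
    fun n => mul_nonneg (Nat.cast_nonneg _)
      (sub_nonneg.2 (one_div_le_one_div_of_le (by positivity) (by linarith)))
  refine (hasSum_iff_tendsto_nat_of_nonneg hnn _).mpr ?_
  have hev : (fun N : ℕ => (harmonic D : ℝ) - D / ((N : ℝ) + 1)) =ᶠ[atTop]
      fun N : ℕ => ∑ n ∈ range N,
        ((min (n + 1) D : ℕ) : ℝ) * (1 / ((n : ℝ) + 1) - 1 / ((n : ℝ) + 2)) := by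
    filter_upwards [eventually_ge_atTop D] with N hN using (sum_majorant_eq_of_ge D hN).symm
  refine Tendsto.congr' hev ?_
  have h1 : Tendsto (fun N : ℕ => (N : ℝ) + 1) atTop atTop :=
    tendsto_atTop_add_const_right _ _ tendsto_natCast_atTop_atTop
  have h2 : Tendsto (fun N : ℕ => (D : ℝ) / ((N : ℝ) + 1)) atTop (𝓝 0) :=
    tendsto_const_nhds.div_atTop h1
  simpa using (tendsto_const_nhds (x := (harmonic D : ℝ))).sub h2

/-! ### `|L(1, χ)| ≤ H_{[(q−1)/2]} ≤ log q` -/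

/-- **`|L(1, χ)| ≤ H_{[(q−1)/2]}`** for every Dirichlet character `χ ≠ 1` mod `q`: in the Abel series
`L(1, χ) = ∑_{n ≥ 1} S(n)(1/n − 1/(n+1))` bound `|S(n)| ≤ min(n, [(q−1)/2])` and sum the majorant.
Oesterlé, p. 57: `∑ χ(n)/n = ∫₁^∞ M(x)x⁻² dx ≤ ∫₁^∞ N(x)x⁻² dx = ∑_{n ≤ [(d−1)/2]} 1/n` (printed for
`χ = (−d/·)`; the argument is the same for any `χ ≠ 1`).
[cite: Oesterle1988Gauss, II §3, proof of the Proposition p. 57] -/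
theorem norm_LFunction_one_le_harmonic (hχ : χ ≠ 1) :
    ‖χ.LFunction 1‖ ≤ (harmonic ((q - 1) / 2) : ℝ) := by
  have h1 : (0 : ℝ) < (1 : ℂ).re := by simp
  rw [LFunction_eq_abelSum χ hχ h1, abelSum]
  refine tsum_of_norm_bounded (hasSum_majorant ((q - 1) / 2)) fun n => ?_
  refine (norm_term_one_le χ n).trans ?_
  have hnn : 0 ≤ 1 / ((n : ℝ) + 1) - 1 / ((n : ℝ) + 2) :=
    sub_nonneg.2 (one_div_le_one_div_of_le (by positivity) (by linarith))
  refine mul_le_mul_of_nonneg_right ?_ hnn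
  rw [Nat.cast_min]
  exact le_min (norm_partialSum_le_self χ (n + 1)) (norm_partialSum_le_half χ hχ (n + 1))

omit [NeZero q] in
/-- **`H_D ≤ log(2D + 1)`** for every `D`: induction, the step being
`1/(D+1) ≤ log(1 + 1/(D + ½)) = log((2D+3)/(2D+1))`, the first term of the series
`log(1 + a⁻¹) = 2∑_k (2k+1)⁻¹(2a+1)^{−(2k+1)}` (`a = D + ½`). With `d = 2D + 1` this is the last
inequality `∑_{n ≤ [(d−1)/2]} 1/n ≤ log d` of Oesterlé's display p. 57 (for even `d` use
`log(d − 1) ≤ log d`). [cite: Oesterle1988Gauss, II §3, proof of the Proposition p. 57] -/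
theorem harmonic_le_log_two_mul_add_one (D : ℕ) : (harmonic D : ℝ) ≤ Real.log (2 * D + 1) := by
  induction D with
  | zero => simp
  | succ D ih =>
    have ha : (0 : ℝ) < (D : ℝ) + 1 / 2 := by positivity
    have hstep : ((D : ℝ) + 1)⁻¹ ≤ Real.log (1 + ((D : ℝ) + 1 / 2)⁻¹) := by
      have hs := Real.hasSum_log_one_add_inv ha
      have h0 := le_hasSum hs 0 (fun k _ => by positivity)
      have hne1 : (2 : ℝ) * ((D : ℝ) + 1 / 2) + 1 ≠ 0 := by positivity
      have hne2 : (D : ℝ) + 1 ≠ 0 := by positivity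
      have hne3 : (2 : ℝ) + (D : ℝ) * 2 ≠ 0 := by positivity
      have e : (2 : ℝ) * (1 / (2 * ((0 : ℕ) : ℝ) + 1)) * (1 / (2 * ((D : ℝ) + 1 / 2) + 1)) ^ (2 * 0 + 1) =
          ((D : ℝ) + 1)⁻¹ := by
        rw [show (2 : ℝ) * ((D : ℝ) + 1 / 2) + 1 = 2 * ((D : ℝ) + 1) by ring]
        simp only [Nat.cast_zero, mul_zero, zero_add, div_one, mul_one, pow_one]
        field_simp
      rw [e] at h0
      exact h0
    have hmul : Real.log (2 * D + 1) + Real.log (1 + ((D : ℝ) + 1 / 2)⁻¹) =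
        Real.log (2 * ((D + 1 : ℕ) : ℝ) + 1) := by
      rw [← Real.log_mul (by positivity) (by positivity)]
      congr 1
      push_cast
      field_simp
      ring
    calc (harmonic (D + 1) : ℝ) = harmonic D + ((D : ℝ) + 1)⁻¹ := by
          push_cast [harmonic_succ]; ring
      _ ≤ Real.log (2 * D + 1) + Real.log (1 + ((D : ℝ) + 1 / 2)⁻¹) := add_le_add ih hstep
      _ = Real.log (2 * ((D + 1 : ℕ) : ℝ) + 1) := hmul

/-- **`|L(1, χ)| ≤ log q` for every Dirichlet character `χ ≠ 1` mod `q`**: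
`|L(1, χ)| ≤ H_{[(q−1)/2]} ≤ log(2[(q−1)/2] + 1) ≤ log q`. For the Kronecker character of an
imaginary quadratic field this is Oesterlé's «`∑_{n ≥ 1} χ(n)/n ≤ log d`» (p. 57).
[cite: Oesterle1988Gauss, II §3, proof of the Proposition p. 57] -/
theorem norm_LFunction_one_le_log (hχ : χ ≠ 1) : ‖χ.LFunction 1‖ ≤ Real.log q := by
  have hq : 1 ≤ q := NeZero.one_le
  refine (norm_LFunction_one_le_harmonic χ hχ).trans
    ((harmonic_le_log_two_mul_add_one _).trans (Real.log_le_log (by positivity) ?_))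
  have h : 2 * ((q - 1) / 2) + 1 ≤ q := by omega
  exact_mod_cast h

end Literature.NumberTheory.LFunctions.DirichletAbel

end
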